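import Literature.AlgebraicGeometry.HodgeTheory.WeilClassesFieldQuaternionMatricesDecomposable
import HarnessLib

/-!
# Moonen–Zarhin's Criterion (2), THE TYPE-2 ROW WITH `m = 1` on `A` itself: every subfield `F` of a quaternion algebra
# `D = ℚ(ψ)⟨α, β⟩ ⊆ End⁰(A)` over a real-multiplication field of any degree has decomposable, hence algebraic, Weil
# classes — by normalising `α^*, β^*` place by place in `ℂ[ψ^*]` (Moonen–Zarhin 1998 §1)

Layer `Literature/AlgebraicGeometry/HodgeTheory`; THEOREMS ONLY — no definition, no named fact, no `sorry` (D-0026, net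
debt 0).  The `m = 1` companion of the seat's `WeilClassesFieldQuaternionOverRealFieldMatricesDecomposable` (powers
`A^{n+1}`), stated on `A` without the biproduct `⨁_{Fin 1} A`; removes the «centre `ℚ`» restriction of
`WeilClassesFieldDecomposableOfMatrixUnits` (`…_of_quaternionPair`).

## The print

B. J. J. Moonen, Yu. G. Zarhin, *Weil classes on abelian varieties*, J. reine angew. Math. 496 (1998) 83–92 =
arXiv:alg-geom/9612017 [MoonenZarhin1998WeilClasses] (held text `paper:arxiv-alg-geom_9612017`), §1 Criterion (2)
(chunk p0003 L46–L58) and its proof (L82–L90): for `X = Y` simple of TYPE 2 (`End⁰(Y) = D` a quaternion algebra over a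
totally real field `E₀`, `B = D`), EVERY subfield `F ⊆ D` has `W_F` consisting of decomposable Hodge classes («First
assume that `X` is either of type 1, 2 … `G_div(X) ⊆ Sl_F(V_X)`, hence `G_div(X)` acts trivially on `W_F`»); the
places (chunk p0002 L104–L118): «`Δ ⊗ ℂ = ∏_{τ ∈ Σ_{E₀}} Δ_ℂ^{(τ)}` … Type 2: `Δ_ℂ^{(τ)} ≅ M₂(ℂ)`».

## What is proved (on `H¹(A(ℂ); ℂ)`)

§0 (private, as in the power version) polynomial / spectral calculus and the normalisation `sq_normaliser`.
§1 **`weilClassesField_le_divisorClassesSpan_of_mem_adjoin_quaternionOver`** — `h ∈ B¹ ⊗ ℂ`, `Q_h` non-degenerate;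
`ψ^*` `Q_h`-symmetric, `Q(ψ) = 0` (`Q` monic irreducible over `ℚ`); `α^*, β^*` `Q_h`-symmetric, commuting with `ψ^*`,
`α^{*2} = a(ψ^*)`, `β^{*2} = b(ψ^*)` (`a(z) b(z) ≠ 0` at the roots of `Q`), `α^*β^* = -β^*α^*`; `φ^* ∈ ℂ⟨ψ^*, α^*, β^*⟩`,
`P(φ) = 0` (`P` monic irreducible, `deg P · 2m = 2 dim A`) ⟹ `W_F ⊗ ℂ ≤ 𝒟ᵐ ⊗ ℂ`; `…_le_hodgeClassSpan_…`,
**`…_le_algebraicClasses_…`**, `mem_algebraicClasses_of_mem_weilClassesField_of_mem_adjoin_quaternionOver`.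

Scope (honest column).  As the power version: every quaternion algebra over `E₀ = ℚ(ψ)` presented by a Rosati-symmetric
anticommuting pair with squares in `E₀^×` (the presentation's existence is not formalised); any `A`, no `End⁰`
identification, no algebraic groups, no classification.

## References

* [MoonenZarhin1998WeilClasses] B. J. J. Moonen, Yu. G. Zarhin, Weil classes on abelian varieties, J. reine angew.
  Math. 496 (1998) 83–92; arXiv:alg-geom/9612017: §1 Criterion (2) and its proof (chunk p0003 L46–L90), Tables 1–2,
  «Δ ⊗ ℂ = ∏ Δ^{(τ)}» (chunk p0002 L60–L118).
* [LangeBirkenhake1992] H. Lange, Ch. Birkenhake, Complex Abelian Varieties (1992), §5.1, §5.3.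
* [McconnellRobson2001] J. C. McConnell, J. C. Robson, Noncommutative Noetherian Rings, GSM 30 (AMS 2001), 3.5.5–3.5.7.
* [HornJohnson2013] R. A. Horn, C. R. Johnson, Matrix Analysis, 2nd ed. (CUP 2013), §1.1 and §1.3.
* [vanGeemen1994HodgeAV] B. van Geemen, LNM 1594 (1994), §2.4.
* [VoisinHodgeI2002] C. Voisin, Hodge Theory and Complex Algebraic Geometry I (CUP 2002), Thm. 11.30.

## Provenance

Lane `lit-hodgefound` (Track 2, Layer A), prover seat `lit-hodgefound-p21` (generation 21), row g21-#9.
-/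

noncomputable section

open CategoryTheory CategoryTheory.Limits
open Literature.AlgebraicTopology.SingularHomology
open Literature.AlgebraicGeometry.Motives
open Literature.AlgebraicGeometry.VanGeemen1994 (hodgeClassSpan pullbackOne)
open Literature.AlgebraicGeometry.Milne1999
open Literature.Geometry.Kaehler (lefschetzPow)
open Literature.Barriers.HodgeConjecture (divisorClassesSpan)
open Literature.LinearAlgebra
open Polynomial

namespace Literature.AlgebraicGeometry.HodgeTheory

/-! ### §0 (private) polynomial and spectral calculus -/

section Aux

variable {M : Type*} [AddCommGroup M] [Module ℂ M]

/-- `L ∘ q(f) = q(g) ∘ L` when `L ∘ f = g ∘ L`. [folklore] -/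
private theorem map_aeval_apply_of_semiconj {N : Type*} [AddCommGroup N] [Module ℂ N] (L : M →ₗ[ℂ] N)
    (f : Module.End ℂ M) (g : Module.End ℂ N) (hc : ∀ v, L (f v) = g (L v)) (q : ℂ[X]) (v : M) :
    L (aeval f q v) = aeval g q (L v) := by
  induction q using Polynomial.induction_on' generalizing v with
  | add p q hp hq => rw [map_add, map_add, LinearMap.add_apply, LinearMap.add_apply, map_add, hp, hq]
  | monomial k c =>
    rw [aeval_monomial, aeval_monomial, Module.End.mul_apply, Module.End.mul_apply,
      Module.algebraMap_end_apply, Module.algebraMap_end_apply, map_smul]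
    congr 1
    induction k generalizing v with
    | zero => rw [pow_zero, pow_zero, Module.End.one_apply, Module.End.one_apply]
    | succ k ih => rw [pow_succ, pow_succ, Module.End.mul_apply, Module.End.mul_apply, ih, hc]

/-- `q(T)` commutes with `U` when `T` does. [folklore] -/
private theorem aeval_comm_of_comm (T U : Module.End ℂ M) (hc : T * U = U * T) (q : ℂ[X]) :
    aeval T q * U = U * aeval T q := by
  refine LinearMap.ext fun v ↦ ?_
  rw [Module.End.mul_apply, Module.End.mul_apply]
  exact (map_aeval_apply_of_semiconj U T T (fun v ↦ by rw [← Module.End.mul_apply, ← hc, Module.End.mul_apply]) q v).symm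

/-- A polynomial in a `B`-self-adjoint operator is `B`-self-adjoint, for any bilinear map `B`. [folklore] -/
private theorem pairing_aeval_symm {W : Type*} [AddCommGroup W] [Module ℂ W] (B : M →ₗ[ℂ] M →ₗ[ℂ] W)
    (T : Module.End ℂ M) (hT : ∀ v w, B (T v) w = B v (T w)) (q : ℂ[X]) (v w : M) :
    B (aeval T q v) w = B v (aeval T q w) := by
  induction q using Polynomial.induction_on' generalizing v w with
  | add p q hp hq => rw [map_add, LinearMap.add_apply, LinearMap.add_apply, map_add, LinearMap.add_apply, map_add, hp, hq]
  | monomial k c =>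
    rw [aeval_monomial, Module.End.mul_apply, Module.End.mul_apply, Module.algebraMap_end_apply,
      Module.algebraMap_end_apply, map_smul, LinearMap.smul_apply, map_smul]
    congr 1
    induction k generalizing v w with
    | zero => rw [pow_zero, Module.End.one_apply, Module.End.one_apply]
    | succ k ih =>
      conv_lhs => rw [pow_succ', Module.End.mul_apply]
      rw [hT, ih, ← Module.End.mul_apply, ← pow_succ]

/-- Functional calculus on an eigen-idempotent: `T P = z P ⟹ q(T) P = q(z) P`. [folklore] -/
private theorem aeval_mul_eq_eval_smul {T P : Module.End ℂ M} {z : ℂ} (hTP : T * P = z • P) (q : ℂ[X]) :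
    aeval T q * P = q.eval z • P := by
  induction q using Polynomial.induction_on' with
  | add p q hp hq => rw [map_add, add_mul, hp, hq, eval_add, add_smul]
  | monomial k c =>
    have hk : ∀ k : ℕ, T ^ k * P = z ^ k • P := by
      intro k
      induction k with
      | zero => rw [pow_zero, pow_zero, one_mul, one_smul]
      | succ k ih => rw [pow_succ, mul_assoc, hTP, mul_smul_comm, ih, smul_smul, pow_succ, mul_comm z]
    rw [aeval_monomial, eval_monomial, mul_assoc, hk, Algebra.algebraMap_eq_smul_one, smul_mul_assoc, one_mul,
      smul_smul]

/-- If `Σ_z P_z = 1`, two operators agreeing on every `P_z` are equal. [folklore] -/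
private theorem eq_of_forall_mul_proj_eq {κ : Type*} {s : Finset κ} {P : κ → Module.End ℂ M}
    (hPsum : ∑ z ∈ s, P z = 1) {L L' : Module.End ℂ M} (hL : ∀ z ∈ s, L * P z = L' * P z) : L = L' := by
  rw [← mul_one L, ← hPsum, Finset.mul_sum, ← mul_one L', ← hPsum, Finset.mul_sum]
  exact Finset.sum_congr rfl hL

/-- `(Σ_w c_w ℓ_w)(z) = c_z` for the Lagrange basis `ℓ_w` of a finite `s ∋ z`. [folklore] -/
private theorem eval_sum_C_mul_basis {s : Finset ℂ} (c : ℂ → ℂ) {z : ℂ} (hz : z ∈ s) :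
    (∑ w ∈ s, C (c w) * Lagrange.basis s id w).eval z = c z := by
  classical
  rw [Polynomial.eval_finsetSum, Finset.sum_eq_single_of_mem z hz fun w _ hwz ↦ ?_]
  · have h1 : (Lagrange.basis s id z).eval z = 1 := Lagrange.eval_basis_self (v := id) (Set.injOn_id _) hz
    rw [eval_mul, eval_C, h1, mul_one]
  · have h0 : (Lagrange.basis s id w).eval z = 0 := Lagrange.eval_basis_of_ne (v := id) hwz hz
    rw [eval_mul, eval_C, h0, mul_zero]

/-- **The normalisation.** If `S² = q(T)`, `S` commutes with `T`, `T` has simple spectrum `s` and `q(z) = c_z² ≠ 0` on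
`s`, then `R = Σ_z c_z⁻¹ P_z ∈ ℂ[T]` satisfies `(S R)² = 1` and `R · (Σ_z c_z P_z) = 1`. [folklore] -/
private theorem sq_normaliser {T S : Module.End ℂ M} {s : Finset ℂ} (hs : s.Nonempty)
    (hTs : aeval T (Lagrange.nodal s id) = 0) {q : ℂ[X]} (hS2 : S * S = aeval T q) (hTS : T * S = S * T)
    {c : ℂ → ℂ} (hc : ∀ z ∈ s, q.eval z = c z * c z) (hc0 : ∀ z ∈ s, c z ≠ 0) :
    S * aeval T (∑ w ∈ s, C ((c w)⁻¹) * Lagrange.basis s id w) *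
        (S * aeval T (∑ w ∈ s, C ((c w)⁻¹) * Lagrange.basis s id w)) = 1 ∧
      aeval T (∑ w ∈ s, C ((c w)⁻¹) * Lagrange.basis s id w) * aeval T (∑ w ∈ s, C (c w) * Lagrange.basis s id w) = 1 := by
  classical
  obtain ⟨hPsum, -, -, hTP⟩ := aeval_lagrange_basis_spectral T s hs hTs
  set R := aeval T (∑ w ∈ s, C ((c w)⁻¹) * Lagrange.basis s id w) with hRdef
  set R' := aeval T (∑ w ∈ s, C (c w) * Lagrange.basis s id w) with hR'def
  have hRP : ∀ z ∈ s, R * aeval T (Lagrange.basis s id z) = (c z)⁻¹ • aeval T (Lagrange.basis s id z) :=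
    fun z hz ↦ by rw [hRdef, aeval_mul_eq_eval_smul (hTP z hz), eval_sum_C_mul_basis (fun w ↦ (c w)⁻¹) hz]
  have hR'P : ∀ z ∈ s, R' * aeval T (Lagrange.basis s id z) = c z • aeval T (Lagrange.basis s id z) :=
    fun z hz ↦ by rw [hR'def, aeval_mul_eq_eval_smul (hTP z hz), eval_sum_C_mul_basis c hz]
  have hRS : R * S = S * R := aeval_comm_of_comm T S hTS _
  refine ⟨?_, ?_⟩
  · have hSS : S * R * (S * R) = aeval T q * (R * R) := by
      rw [mul_assoc, ← mul_assoc R S, hRS, mul_assoc, ← mul_assoc S S, hS2]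
    refine eq_of_forall_mul_proj_eq hPsum fun z hz ↦ ?_
    rw [hSS, one_mul, mul_assoc, mul_assoc, hRP z hz, mul_smul_comm, hRP z hz, smul_smul, mul_smul_comm,
      aeval_mul_eq_eval_smul (hTP z hz), smul_smul, hc z hz,
      show (c z)⁻¹ * (c z)⁻¹ * (c z * c z) = 1 by field_simp [hc0 z hz], one_smul]
  · refine eq_of_forall_mul_proj_eq hPsum fun z hz ↦ ?_
    rw [one_mul, mul_assoc, hR'P z hz, mul_smul_comm, hRP z hz, smul_smul, mul_inv_cancel₀ (hc0 z hz), one_smul]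

end Aux

/-- The complex roots of a monic integer polynomial irreducible over `ℚ` are simple and non-empty, with nodal
polynomial the polynomial itself. [folklore] -/
private theorem nodal_roots_toFinset {Q : Polynomial ℤ} (hQm : Q.Monic)
    (hQirr : Irreducible (Q.map (Int.castRingHom ℚ))) :
    Lagrange.nodal (Q.map (Int.castRingHom ℂ)).roots.toFinset id = Q.map (Int.castRingHom ℂ) ∧
      (Q.map (Int.castRingHom ℂ)).roots.toFinset.Nonempty := by
  classical
  have hQc : Q.map (Int.castRingHom ℂ) = (Q.map (Int.castRingHom ℚ)).map (algebraMap ℚ ℂ) := by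
    rw [Polynomial.map_map, RingHom.ext_int ((algebraMap ℚ ℂ).comp (Int.castRingHom ℚ)) (Int.castRingHom ℂ)]
  have hsep : (Q.map (Int.castRingHom ℂ)).Separable := by
    rw [hQc]
    exact hQirr.separable.map
  have hmon : (Q.map (Int.castRingHom ℂ)).Monic := hQm.map _
  have hnodup : (Q.map (Int.castRingHom ℂ)).roots.Nodup := Polynomial.nodup_roots hsep
  refine ⟨?_, ?_⟩
  · have hsplit := (IsAlgClosed.splits (Q.map (Int.castRingHom ℂ))).eq_prod_roots_of_monic hmon
    rw [Lagrange.nodal_eq, ← Multiset.toFinset_eq hnodup, Finset.prod_mk]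
    exact hsplit.symm
  · have hdeg : (Q.map (Int.castRingHom ℂ)).degree ≠ 0 := by
      have h1 : 0 < (Q.map (Int.castRingHom ℚ)).natDegree :=
        Polynomial.natDegree_pos_iff_degree_pos.2 (Polynomial.degree_pos_of_irreducible hQirr)
      rw [hQm.natDegree_map] at h1
      intro h0
      rw [Polynomial.degree_eq_natDegree hmon.ne_zero, hQm.natDegree_map] at h0
      exact h1.ne' (by exact_mod_cast h0)
    obtain ⟨z, hz⟩ := IsAlgClosed.exists_root _ hdeg
    exact ⟨z, Multiset.mem_toFinset.2 ((Polynomial.mem_roots hmon.ne_zero).2 hz)⟩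

/-! ### §1 THE TYPE-2 ROW WITH `m = 1`: a quaternion algebra over the real-multiplication centre, on `A` itself -/

section QuaternionOverRealFieldSimple

variable {A : AbelianVariety ℂ} {h : complexBetti A.X 2} {ψ α β φ : A ⟶ A} {qa qb : ℂ[X]} {P Q : Polynomial ℤ} {e m : ℕ}

/-- **THE TYPE-2 ROW WITH `m = 1` — `W_F(A)` IS DECOMPOSABLE FOR EVERY SUBFIELD `F ⊆ D = ℚ(ψ)⟨α, β⟩`, `D` A QUATERNION
ALGEBRA OVER THE REAL-MULTIPLICATION FIELD `E₀ = ℚ(ψ)`, ON `A` ITSELF.** Let `A` be a complex abelian variety with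
`h ∈ B¹(A) ⊗ ℂ` and `Q_h` non-degenerate; `ψ ∈ End(A)` ROSATI-SYMMETRIC with `Q(ψ) = 0`, `Q ∈ ℤ[T]` monic irreducible
over `ℚ` (centre `E₀ = ℚ(ψ)` of any degree); `α, β ∈ End(A)` Rosati-symmetric, commuting with `ψ^*`, anticommuting,
`α^{*2} = a(ψ^*)`, `β^{*2} = b(ψ^*)` with `a(z) b(z) ≠ 0` at every complex root `z` of `Q` (`α², β² ∈ E₀^×`); and
`φ ∈ End(A)` with `φ^* ∈ ℂ⟨ψ^*, α^*, β^*⟩` — `F = ℚ(φ) ⊆ D` — `P(φ) = 0`, `P` monic irreducible of degree `e`,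
`e · 2m = 2 dim A`. Then `W_F ⊗ ℂ ≤ 𝒟ᵐ ⊗ ℂ`. Proof: the normalised pair `S = α^* · Σ_z a(z)^{-1/2} P_z`,
`T′ = β^* · Σ_z b(z)^{-1/2} P_z` (`P_z` the Lagrange projectors of `ψ^*`; `S² = T′² = 1`, `S T′ = -T′ S`, both
Rosati-symmetric, in `B ⊗ ℂ`) has a `Q_h`-orthogonal `2 × 2` block `(x, y, p)` inside `ℂ⟨S, T′⟩`
(`exists_matrixUnits_of_symmetric_anticommuting_pair`) — a Morita datum over `Fin 2` commuting with `ψ^*`, whose span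
together with `ℂ[ψ^*]` contains `α^* = S · Σ_z a(z)^{1/2} P_z` and `β^*`; then
`weilClassesField_le_divisorClassesSpan_of_moritaData_of_symmetric`. This is the print's row «`Y` of Type 2, `m = 1`,
`F ⊆ B = D`: decomposable» for a centre of ANY degree (the seat's `…_of_quaternionPair` had centre `ℚ`; the power
version is `…_of_mem_adjoin_quaternionOver_diagonal`), on the carrier, with no algebraic groups; any `A` (no
simplicity, no identification `End⁰(A) = D`). [cite: MoonenZarhin1998WeilClasses, §1 Criterion (2) and its proof, type 2 (chunk p0003 L46–L90); Tables 1–2 and «Δ ⊗ ℂ = ∏_τ Δ_ℂ^{(τ)}» (chunk p0002 L60–L118)]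
[cite: McconnellRobson2001, 3.5.5–3.5.7] [cite: HornJohnson2013, §1.1 and §1.3] -/
theorem weilClassesField_le_divisorClassesSpan_of_mem_adjoin_quaternionOver
    (hPm : P.Monic) (hPe : P.natDegree = e) (hPirr : Irreducible (P.map (Int.castRingHom ℚ)))
    (hφ : Polynomial.eval₂ (Int.castRingHom (CategoryTheory.End A)) (φ : CategoryTheory.End A) P = 0)
    (her : e * (2 * m) = 2 * A.dim) (hh : h ∈ hodgeClassSpan A.dim A.X 1)
    (hnd : ∀ v : complexBetti A.X 1, (∀ w, polarizationPairingOne A.X h (A.dim - 1) v w = 0) → v = 0)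
    (hψsym : ∀ v w : complexBetti A.X 1, polarizationPairingOne A.X h (A.dim - 1) (pullbackOne A ψ v) w =
      polarizationPairingOne A.X h (A.dim - 1) v (pullbackOne A ψ w))
    (hQm : Q.Monic) (hQirr : Irreducible (Q.map (Int.castRingHom ℚ)))
    (hψQ : Polynomial.eval₂ (Int.castRingHom (CategoryTheory.End A)) (ψ : CategoryTheory.End A) Q = 0)
    (hα2 : pullbackOne A α * pullbackOne A α = aeval (pullbackOne A ψ) qa)
    (hqa : ∀ z : ℂ, (Q.map (Int.castRingHom ℂ)).IsRoot z → qa.eval z ≠ 0)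
    (hβ2 : pullbackOne A β * pullbackOne A β = aeval (pullbackOne A ψ) qb)
    (hqb : ∀ z : ℂ, (Q.map (Int.castRingHom ℂ)).IsRoot z → qb.eval z ≠ 0)
    (hanti : pullbackOne A α * pullbackOne A β = -(pullbackOne A β * pullbackOne A α))
    (hαsym : ∀ v w : complexBetti A.X 1, polarizationPairingOne A.X h (A.dim - 1) (pullbackOne A α v) w =
      polarizationPairingOne A.X h (A.dim - 1) v (pullbackOne A α w))
    (hβsym : ∀ v w : complexBetti A.X 1, polarizationPairingOne A.X h (A.dim - 1) (pullbackOne A β v) w =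
      polarizationPairingOne A.X h (A.dim - 1) v (pullbackOne A β w))
    (hψα : pullbackOne A ψ * pullbackOne A α = pullbackOne A α * pullbackOne A ψ)
    (hψβ : pullbackOne A ψ * pullbackOne A β = pullbackOne A β * pullbackOne A ψ)
    (hF : pullbackOne A φ ∈ Algebra.adjoin ℂ
      ({pullbackOne A ψ, pullbackOne A α, pullbackOne A β} : Set (Module.End ℂ (complexBetti A.X 1)))) :
    weilClassesField A φ P (2 * m) ≤ divisorClassesSpan A.X A.dim m := by
  classical
  set T : Module.End ℂ (complexBetti A.X 1) := pullbackOne A ψ with hTdef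
  set Sa : Module.End ℂ (complexBetti A.X 1) := pullbackOne A α with hSadef
  set Sb : Module.End ℂ (complexBetti A.X 1) := pullbackOne A β with hSbdef
  have hT_symm : T ∈ symmetricPullbackSpan A h := ⟨Submodule.subset_span ⟨ψ, rfl⟩, hψsym⟩
  have hSa_full : Sa ∈ symmetricPullbackSpan A h := ⟨Submodule.subset_span ⟨α, rfl⟩, hαsym⟩
  have hSb_full : Sb ∈ symmetricPullbackSpan A h := ⟨Submodule.subset_span ⟨β, rfl⟩, hβsym⟩
  have hTQ : aeval T (Q.map (Int.castRingHom ℂ)) = 0 := aeval_hom_complexBetti_map_one_eq_zero hψQ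
  set s : Finset ℂ := (Q.map (Int.castRingHom ℂ)).roots.toFinset with hsdef
  obtain ⟨hnodal, hsne⟩ := nodal_roots_toFinset hQm hQirr
  have hTnodal : aeval T (Lagrange.nodal s id) = 0 := by rw [hsdef, hnodal, hTQ]
  have hmem_s : ∀ z ∈ s, (Q.map (Int.castRingHom ℂ)).IsRoot z := fun z hz ↦ by
    rw [hsdef] at hz
    exact (Polynomial.mem_roots (hQm.map _).ne_zero).1 (Multiset.mem_toFinset.1 hz)
  -- square roots of `a(z)`, `b(z)` at the places `z`
  have hσex : ∀ z : ℂ, ∃ σ : ℂ, qa.eval z = σ * σ := fun z ↦ IsAlgClosed.exists_eq_mul_self _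
  have hτex : ∀ z : ℂ, ∃ τ : ℂ, qb.eval z = τ * τ := fun z ↦ IsAlgClosed.exists_eq_mul_self _
  choose σ hσ using hσex
  choose τ hτ using hτex
  have hσ0 : ∀ z ∈ s, σ z ≠ 0 := fun z hz h0 ↦ hqa z (hmem_s z hz) (by rw [hσ z, h0, mul_zero])
  have hτ0 : ∀ z ∈ s, τ z ≠ 0 := fun z hz h0 ↦ hqb z (hmem_s z hz) (by rw [hτ z, h0, mul_zero])
  -- the normalised pair
  obtain ⟨hS2, hRaRa'⟩ := sq_normaliser hsne hTnodal hα2 hψα (fun z hz ↦ hσ z) hσ0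
  obtain ⟨hT2, hRbRb'⟩ := sq_normaliser hsne hTnodal hβ2 hψβ (fun z hz ↦ hτ z) hτ0
  set Ra : Module.End ℂ (complexBetti A.X 1) := aeval T (∑ w ∈ s, C ((σ w)⁻¹) * Lagrange.basis s id w) with hRadef
  set Ra' : Module.End ℂ (complexBetti A.X 1) := aeval T (∑ w ∈ s, C (σ w) * Lagrange.basis s id w) with hRa'def
  set Rb : Module.End ℂ (complexBetti A.X 1) := aeval T (∑ w ∈ s, C ((τ w)⁻¹) * Lagrange.basis s id w) with hRbdef
  set Rb' : Module.End ℂ (complexBetti A.X 1) := aeval T (∑ w ∈ s, C (τ w) * Lagrange.basis s id w) with hRb'def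
  have hSanti : Sa * Sb = -(Sb * Sa) := hanti
  have hTSa : T * Sa = Sa * T := hψα
  have hTSb : T * Sb = Sb * T := hψβ
  have hRaSa : Ra * Sa = Sa * Ra := aeval_comm_of_comm T Sa hTSa _
  have hRaSb : Ra * Sb = Sb * Ra := aeval_comm_of_comm T Sb hTSb _
  have hRbSa : Rb * Sa = Sa * Rb := aeval_comm_of_comm T Sa hTSa _
  have hRbSb : Rb * Sb = Sb * Rb := aeval_comm_of_comm T Sb hTSb _
  have hRbT : Rb * T = T * Rb := aeval_comm_of_comm T T rfl _
  have hRaT : Ra * T = T * Ra := aeval_comm_of_comm T T rfl _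
  have hRaRb : Ra * Rb = Rb * Ra := aeval_comm_of_comm T Rb hRbT.symm _
  have hRa_adj : ∀ v w : complexBetti A.X 1, polarizationPairingOne A.X h (A.dim - 1) (Ra v) w =
      polarizationPairingOne A.X h (A.dim - 1) v (Ra w) := fun v w ↦ pairing_aeval_symm _ T hT_symm.2 _ v w
  have hRb_adj : ∀ v w : complexBetti A.X 1, polarizationPairingOne A.X h (A.dim - 1) (Rb v) w =
      polarizationPairingOne A.X h (A.dim - 1) v (Rb w) := fun v w ↦ pairing_aeval_symm _ T hT_symm.2 _ v w
  have hCT : ∀ q : ℂ[X], aeval T q ∈ Algebra.adjoin ℂ (symmetricPullbackSpan A h : Set (Module.End ℂ (complexBetti A.X 1))) :=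
    fun q ↦ Algebra.adjoin_mono (Set.singleton_subset_iff.2 hT_symm) (Polynomial.aeval_mem_adjoin_singleton ℂ T)
  set S : Module.End ℂ (complexBetti A.X 1) := Sa * Ra with hSdef
  set T' : Module.End ℂ (complexBetti A.X 1) := Sb * Rb with hT'def
  have hcm : ∀ {L V W : Module.End ℂ (complexBetti A.X 1)}, L * V = V * L → L * W = W * L →
      L * (V * W) = V * W * L := fun h1 h2 ↦ by rw [← mul_assoc, h1, mul_assoc, h2, ← mul_assoc]
  have hST : S * T' = -(T' * S) := by
    have e1 : S * T' = Sa * Sb * (Ra * Rb) := by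
      rw [hSdef, hT'def, mul_assoc, ← mul_assoc Ra Sb, hRaSb, mul_assoc, ← mul_assoc Sa Sb]
    have e2 : T' * S = Sb * Sa * (Ra * Rb) := by
      rw [hSdef, hT'def, mul_assoc, ← mul_assoc Rb Sa, hRbSa, mul_assoc, ← mul_assoc Sb Sa, hRaRb]
    rw [e1, e2, hSanti, neg_mul]
  have hS_symm : ∀ v w : complexBetti A.X 1, polarizationPairingOne A.X h (A.dim - 1) (S v) w =
      polarizationPairingOne A.X h (A.dim - 1) v (S w) := by
    intro v w
    rw [hSdef, Module.End.mul_apply, hSa_full.2, hRa_adj, ← Module.End.mul_apply, hRaSa]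
  have hT'_symm : ∀ v w : complexBetti A.X 1, polarizationPairingOne A.X h (A.dim - 1) (T' v) w =
      polarizationPairingOne A.X h (A.dim - 1) v (T' w) := by
    intro v w
    rw [hT'def, Module.End.mul_apply, hSb_full.2, hRb_adj, ← Module.End.mul_apply, hRbSb]
  have hS_mem : S ∈ Algebra.adjoin ℂ (symmetricPullbackSpan A h : Set (Module.End ℂ (complexBetti A.X 1))) :=
    Subalgebra.mul_mem _ (Algebra.subset_adjoin hSa_full) (hCT _)
  have hT'_mem : T' ∈ Algebra.adjoin ℂ (symmetricPullbackSpan A h : Set (Module.End ℂ (complexBetti A.X 1))) :=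
    Subalgebra.mul_mem _ (Algebra.subset_adjoin hSb_full) (hCT _)
  have hS2' : S * S = (1:ℂ) • 1 := by rw [one_smul]; exact hS2
  have hT2' : T' * T' = (1:ℂ) • 1 := by rw [one_smul]; exact hT2
  have hTS : T * S = S * T := hcm hTSa hRaT.symm
  have hTT' : T * T' = T' * T := hcm hTSb hRbT.symm
  -- the `2 × 2` block of the normalised pair: a Morita datum over `Fin 2` commuting with `T`
  obtain ⟨x, y, p, hyx, hsum, hadj, hx, hy, hST', hxgen, hygen⟩ :=
    exists_matrixUnits_of_symmetric_anticommuting_pair (A := A) (h := h) one_ne_zero hS2' one_ne_zero hT2' hST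
      hS_symm hT'_symm hS_mem hT'_mem
  have hcomm : ∀ L : Module.End ℂ (complexBetti A.X 1), L * S = S * L → L * T' = T' * L →
      ∀ g ∈ Algebra.adjoin ℂ ({S, T'} : Set (Module.End ℂ (complexBetti A.X 1))), L * g = g * L := by
    intro L hLa hLb g hg
    have hL : L ∈ Subalgebra.centralizer ℂ ({S, T'} : Set (Module.End ℂ (complexBetti A.X 1))) := by
      rw [Subalgebra.mem_centralizer_iff]
      rintro g' (rfl | rfl)
      · exact hLa.symm
      · exact hLb.symm
    have hg' := Algebra.adjoin_le_centralizer_centralizer ℂ ({S, T'} : Set (Module.End ℂ (complexBetti A.X 1))) hg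
    rw [Subalgebra.mem_centralizer_iff] at hg'
    exact hg' L hL
  have hTx : ∀ i, T * x i = x i * T := fun i ↦ hcomm _ hTS hTT' _ (hxgen i)
  have hTy : ∀ i, T * y i = y i * T := fun i ↦ hcomm _ hTS hTT' _ (hygen i)
  -- the generators lie in `ℂ⟨T, x y⟩`
  have hSa_eq : Sa = S * Ra' := by rw [hSdef, mul_assoc, hRaRa', mul_one]
  have hSb_eq : Sb = T' * Rb' := by rw [hT'def, mul_assoc, hRbRb', mul_one]
  have hgens : ({T, Sa, Sb} : Set (Module.End ℂ (complexBetti A.X 1))) ⊆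
      (Algebra.adjoin ℂ (insert T (Set.range fun ij : Fin 2 × Fin 2 ↦ x ij.1 * y ij.2)) :
        Set (Module.End ℂ (complexBetti A.X 1))) := by
    have hWR : Submodule.span ℂ (Set.range fun ij : Fin 2 × Fin 2 ↦ x ij.1 * y ij.2) ≤
        Subalgebra.toSubmodule (Algebra.adjoin ℂ (insert T (Set.range fun ij : Fin 2 × Fin 2 ↦ x ij.1 * y ij.2))) :=
      Submodule.span_le.2 fun g hg ↦ Algebra.subset_adjoin (Set.mem_insert_of_mem _ hg)
    have hPT : ∀ q : ℂ[X], aeval T q ∈ Algebra.adjoin ℂ (insert T (Set.range fun ij : Fin 2 × Fin 2 ↦ x ij.1 * y ij.2)) :=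
      fun q ↦ Algebra.adjoin_mono (Set.singleton_subset_iff.2 (Set.mem_insert _ _))
        (Polynomial.aeval_mem_adjoin_singleton ℂ T)
    refine Set.insert_subset_iff.2 ⟨Algebra.subset_adjoin (Set.mem_insert _ _), Set.insert_subset_iff.2
      ⟨?_, Set.singleton_subset_iff.2 ?_⟩⟩
    · rw [hSa_eq, hRa'def]
      exact Subalgebra.mul_mem _ (hWR (hST' (Set.mem_insert _ _))) (hPT _)
    · rw [hSb_eq, hRb'def]
      exact Subalgebra.mul_mem _ (hWR (hST' (Set.mem_insert_of_mem _ (Set.mem_singleton _)))) (hPT _)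
  exact weilClassesField_le_divisorClassesSpan_of_moritaData_of_symmetric hPm hPe hPirr hφ her hh hnd hyx hsum hadj hx
    hy hT_symm hTx hTy hsne hTnodal (Algebra.adjoin_le hgens hF)

/-- **… and consists of HODGE classes** (`W_F ⊗ ℂ ≤ ℬᵐ ⊗ ℂ`). [cite: MoonenZarhin1998WeilClasses, §1 Criterion (2) and the Remark after it («type 1, 2 or 3 ⟹ n_σ = n_σ′»; chunk p0002 L1–L12, p0003 L46–L58)]
[cite: vanGeemen1994HodgeAV, §2.4] -/
theorem weilClassesField_le_hodgeClassSpan_of_mem_adjoin_quaternionOver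
    (hPm : P.Monic) (hPe : P.natDegree = e) (hPirr : Irreducible (P.map (Int.castRingHom ℚ)))
    (hφ : Polynomial.eval₂ (Int.castRingHom (CategoryTheory.End A)) (φ : CategoryTheory.End A) P = 0)
    (her : e * (2 * m) = 2 * A.dim) (hh : h ∈ hodgeClassSpan A.dim A.X 1)
    (hnd : ∀ v : complexBetti A.X 1, (∀ w, polarizationPairingOne A.X h (A.dim - 1) v w = 0) → v = 0)
    (hψsym : ∀ v w : complexBetti A.X 1, polarizationPairingOne A.X h (A.dim - 1) (pullbackOne A ψ v) w =
      polarizationPairingOne A.X h (A.dim - 1) v (pullbackOne A ψ w))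
    (hQm : Q.Monic) (hQirr : Irreducible (Q.map (Int.castRingHom ℚ)))
    (hψQ : Polynomial.eval₂ (Int.castRingHom (CategoryTheory.End A)) (ψ : CategoryTheory.End A) Q = 0)
    (hα2 : pullbackOne A α * pullbackOne A α = aeval (pullbackOne A ψ) qa)
    (hqa : ∀ z : ℂ, (Q.map (Int.castRingHom ℂ)).IsRoot z → qa.eval z ≠ 0)
    (hβ2 : pullbackOne A β * pullbackOne A β = aeval (pullbackOne A ψ) qb)
    (hqb : ∀ z : ℂ, (Q.map (Int.castRingHom ℂ)).IsRoot z → qb.eval z ≠ 0)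
    (hanti : pullbackOne A α * pullbackOne A β = -(pullbackOne A β * pullbackOne A α))
    (hαsym : ∀ v w : complexBetti A.X 1, polarizationPairingOne A.X h (A.dim - 1) (pullbackOne A α v) w =
      polarizationPairingOne A.X h (A.dim - 1) v (pullbackOne A α w))
    (hβsym : ∀ v w : complexBetti A.X 1, polarizationPairingOne A.X h (A.dim - 1) (pullbackOne A β v) w =
      polarizationPairingOne A.X h (A.dim - 1) v (pullbackOne A β w))
    (hψα : pullbackOne A ψ * pullbackOne A α = pullbackOne A α * pullbackOne A ψ)
    (hψβ : pullbackOne A ψ * pullbackOne A β = pullbackOne A β * pullbackOne A ψ)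
    (hF : pullbackOne A φ ∈ Algebra.adjoin ℂ
      ({pullbackOne A ψ, pullbackOne A α, pullbackOne A β} : Set (Module.End ℂ (complexBetti A.X 1)))) :
    weilClassesField A φ P (2 * m) ≤ hodgeClassSpan A.dim A.X m :=
  (weilClassesField_le_divisorClassesSpan_of_mem_adjoin_quaternionOver hPm hPe hPirr hφ her hh hnd hψsym hQm hQirr hψQ hα2 hqa hβ2
      hqb hanti hαsym hβsym hψα hψβ hF).trans
    (divisorClassesSpan_le_hodgeClassSpan_of_isSmoothProjective (AbelianVariety.isSmoothProjective_holds (A := A)) m)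

/-- **… and is ALGEBRAIC**: `W_F ⊗ ℂ ≤ algebraicClasses` — THE WEIL CLASSES OF EVERY SUBFIELD OF THE QUATERNION ALGEBRA
`ℚ(ψ)⟨α, β⟩ ⊆ End⁰(A)` OVER A REAL-MULTIPLICATION FIELD ARE ALGEBRAIC (Lefschetz `(1,1)`, the tree's
`lefschetzOneOne_rational_holds`). [cite: MoonenZarhin1998WeilClasses, Introduction (chunk p0001 L10–L18) and §1 Criterion (2) (chunk p0003 L46–L90)]
[cite: VoisinHodgeI2002, Thm. 11.30] -/
theorem weilClassesField_le_algebraicClasses_of_mem_adjoin_quaternionOver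
    (hPm : P.Monic) (hPe : P.natDegree = e) (hPirr : Irreducible (P.map (Int.castRingHom ℚ)))
    (hφ : Polynomial.eval₂ (Int.castRingHom (CategoryTheory.End A)) (φ : CategoryTheory.End A) P = 0)
    (her : e * (2 * m) = 2 * A.dim) (hh : h ∈ hodgeClassSpan A.dim A.X 1)
    (hnd : ∀ v : complexBetti A.X 1, (∀ w, polarizationPairingOne A.X h (A.dim - 1) v w = 0) → v = 0)
    (hψsym : ∀ v w : complexBetti A.X 1, polarizationPairingOne A.X h (A.dim - 1) (pullbackOne A ψ v) w =
      polarizationPairingOne A.X h (A.dim - 1) v (pullbackOne A ψ w))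
    (hQm : Q.Monic) (hQirr : Irreducible (Q.map (Int.castRingHom ℚ)))
    (hψQ : Polynomial.eval₂ (Int.castRingHom (CategoryTheory.End A)) (ψ : CategoryTheory.End A) Q = 0)
    (hα2 : pullbackOne A α * pullbackOne A α = aeval (pullbackOne A ψ) qa)
    (hqa : ∀ z : ℂ, (Q.map (Int.castRingHom ℂ)).IsRoot z → qa.eval z ≠ 0)
    (hβ2 : pullbackOne A β * pullbackOne A β = aeval (pullbackOne A ψ) qb)
    (hqb : ∀ z : ℂ, (Q.map (Int.castRingHom ℂ)).IsRoot z → qb.eval z ≠ 0)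
    (hanti : pullbackOne A α * pullbackOne A β = -(pullbackOne A β * pullbackOne A α))
    (hαsym : ∀ v w : complexBetti A.X 1, polarizationPairingOne A.X h (A.dim - 1) (pullbackOne A α v) w =
      polarizationPairingOne A.X h (A.dim - 1) v (pullbackOne A α w))
    (hβsym : ∀ v w : complexBetti A.X 1, polarizationPairingOne A.X h (A.dim - 1) (pullbackOne A β v) w =
      polarizationPairingOne A.X h (A.dim - 1) v (pullbackOne A β w))
    (hψα : pullbackOne A ψ * pullbackOne A α = pullbackOne A α * pullbackOne A ψ)
    (hψβ : pullbackOne A ψ * pullbackOne A β = pullbackOne A β * pullbackOne A ψ)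
    (hF : pullbackOne A φ ∈ Algebra.adjoin ℂ
      ({pullbackOne A ψ, pullbackOne A α, pullbackOne A β} : Set (Module.End ℂ (complexBetti A.X 1)))) :
    weilClassesField A φ P (2 * m) ≤ algebraicClasses A.X m :=
  (weilClassesField_le_divisorClassesSpan_of_mem_adjoin_quaternionOver hPm hPe hPirr hφ her hh hnd hψsym hQm hQirr hψQ hα2 hqa hβ2
      hqb hanti hαsym hβsym hψα hψβ hF).trans
    (AbelianVariety.divisorClassesSpan_le_algebraicClasses A
      (fun c hc hc' ↦ lefschetzOneOne_rational_holds (AbelianVariety.isSmoothProjective_holds (A := A)) c hc hc') m)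

/-- Element form: every class of `W_F ⊗ ℂ` — in particular every rational Weil class of a subfield of `ℚ(ψ)⟨α, β⟩` — is a
`ℂ`-combination of algebraic classes. [cite: MoonenZarhin1998WeilClasses, Introduction (chunk p0001 L10–L18) and §1 Criterion (2) (chunk p0003 L46–L90)] -/
theorem mem_algebraicClasses_of_mem_weilClassesField_of_mem_adjoin_quaternionOver
    (hPm : P.Monic) (hPe : P.natDegree = e) (hPirr : Irreducible (P.map (Int.castRingHom ℚ)))
    (hφ : Polynomial.eval₂ (Int.castRingHom (CategoryTheory.End A)) (φ : CategoryTheory.End A) P = 0)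
    (her : e * (2 * m) = 2 * A.dim) (hh : h ∈ hodgeClassSpan A.dim A.X 1)
    (hnd : ∀ v : complexBetti A.X 1, (∀ w, polarizationPairingOne A.X h (A.dim - 1) v w = 0) → v = 0)
    (hψsym : ∀ v w : complexBetti A.X 1, polarizationPairingOne A.X h (A.dim - 1) (pullbackOne A ψ v) w =
      polarizationPairingOne A.X h (A.dim - 1) v (pullbackOne A ψ w))
    (hQm : Q.Monic) (hQirr : Irreducible (Q.map (Int.castRingHom ℚ)))
    (hψQ : Polynomial.eval₂ (Int.castRingHom (CategoryTheory.End A)) (ψ : CategoryTheory.End A) Q = 0)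
    (hα2 : pullbackOne A α * pullbackOne A α = aeval (pullbackOne A ψ) qa)
    (hqa : ∀ z : ℂ, (Q.map (Int.castRingHom ℂ)).IsRoot z → qa.eval z ≠ 0)
    (hβ2 : pullbackOne A β * pullbackOne A β = aeval (pullbackOne A ψ) qb)
    (hqb : ∀ z : ℂ, (Q.map (Int.castRingHom ℂ)).IsRoot z → qb.eval z ≠ 0)
    (hanti : pullbackOne A α * pullbackOne A β = -(pullbackOne A β * pullbackOne A α))
    (hαsym : ∀ v w : complexBetti A.X 1, polarizationPairingOne A.X h (A.dim - 1) (pullbackOne A α v) w =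
      polarizationPairingOne A.X h (A.dim - 1) v (pullbackOne A α w))
    (hβsym : ∀ v w : complexBetti A.X 1, polarizationPairingOne A.X h (A.dim - 1) (pullbackOne A β v) w =
      polarizationPairingOne A.X h (A.dim - 1) v (pullbackOne A β w))
    (hψα : pullbackOne A ψ * pullbackOne A α = pullbackOne A α * pullbackOne A ψ)
    (hψβ : pullbackOne A ψ * pullbackOne A β = pullbackOne A β * pullbackOne A ψ)
    (hF : pullbackOne A φ ∈ Algebra.adjoin ℂ
      ({pullbackOne A ψ, pullbackOne A α, pullbackOne A β} : Set (Module.End ℂ (complexBetti A.X 1))))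
    {c : complexBetti A.X (2 * m)} (hc : c ∈ weilClassesField A φ P (2 * m)) : c ∈ algebraicClasses A.X m :=
  weilClassesField_le_algebraicClasses_of_mem_adjoin_quaternionOver hPm hPe hPirr hφ her hh hnd hψsym hQm hQirr hψQ hα2 hqa hβ2
      hqb hanti hαsym hβsym hψα hψβ hF hc

end QuaternionOverRealFieldSimple

end Literature.AlgebraicGeometry.HodgeTheory

end
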